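import Literature.NumberTheory.EllipticCurves.BernoulliMeasureProofs
import HarnessLib

/-!
# Lang Ch. 2 §2, E 2 / Theorem 2.1 (ii): `E_{k,c}^{(N)}(x) ≡ x^{k-1} E_{1,c}^{(N)}(x) mod N ℤ_p`

Lang, *Cyclotomic Fields I and II*, Ch. 2 §2, **E 2** (PDF p. 35):
`E_{k,c}^{(N)}(x) ≡ x^{k-1} E_{1,c}^{(N)}(x) mod (N/(kD(k))) ℤ[c, 1/c]`, whence Thm. 2.1 (ii)
`E_{k,c}^{(N)}(x) ≡ x^{k-1} E_{1,c}^{(N)}(x) mod N ℤ_p` and, in the limit over `N = p^n`, Thm. 2.2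
`E_{k,c} = x^{k-1} E_{1,c}` as measures on `ℤ_p`.  Lang's proof writes `c⁻¹x = b + yN` and expands
`B_k(X) = X^k − (k/2) X^{k-1} + lower terms` (**B 5**); this file carries it out with explicit
remainder terms, in the form used by the tree's `p`-adic moment machinery
(`PAdicMeasureMoments.tendsto_sum_units_mul_pow_of_moment`: a bound `C p^{-n}` for
`‖ν(a + p^n) − a^j μ(a + p^n)‖`).

* `mul_bernoulli_eval_div_eq` — **B 5** with the lower terms kept;
* `exists_norm_regBernoulliDist_sub_le` — **E 2** / Thm. 2.1 (ii) at an odd prime `p`: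
  `‖k E_{k,c}^{(M)}(b) − k b^{k-1} E_{1,c}^{(M)}(b)‖_p ≤ D ‖M‖_p`, `D` depending on `k`, `p` only.

Everything is proved; there are no named facts.

## References

* S. Lang, *Cyclotomic Fields I and II*, GTM 121, Springer 1990, Ch. 2 §2: **B 5**, **E 2**,
  Theorems 2.1, 2.2 (PDF pp. 34–37). [LangCyclotomic1990]
-/

noncomputable section

open Finset Nat

namespace Literature.NumberTheory.EllipticCurves

/-! ### B 5 with remainder: `M · M^j B_{j+1}(x/M) = x^{j+1} − ((j+1)/2) x^j M + M² S` -/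

section Expansion

/-- **Lang Ch. 2 §2, B 5 with the lower terms kept**: for `k = j + 1`,
`M · M^{j} B_{j+1}(x/M) = x^{j+1} − ((j+1)/2) x^j M + M² · ∑_{i<j} B_{j+1-i} C(j+1,i) x^{i} M^{j-1-i}`
(expansion of `B_{j+1}(X) = ∑_i C(j+1,i) B_{j+1-i} X^{i}`, Mathlib `Polynomial.bernoulli_def`).
[cite: LangCyclotomic1990, Ch. 2 §2, B 5 and proof of E 2 (PDF pp. 34–35)] -/
theorem mul_bernoulli_eval_div_eq (j : ℕ) {M : ℚ} (hM : M ≠ 0) (x : ℚ) :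
    M * (M ^ j * (Polynomial.bernoulli (j + 1)).eval (x / M)) =
      x ^ (j + 1) - ((j : ℚ) + 1) / 2 * x ^ j * M +
        M ^ 2 * ∑ i ∈ range j, (_root_.bernoulli (j + 1 - i) * ((j + 1).choose i : ℕ) : ℚ) *
          x ^ i * M ^ (j - 1 - i) := by
  rw [Polynomial.bernoulli_def, Polynomial.eval_finsetSum, Finset.sum_range_succ,
    Finset.sum_range_succ]
  simp only [Polynomial.eval_monomial, Nat.choose_self, Nat.cast_one, mul_one, bernoulli_zero,
    Nat.sub_self, show j + 1 - j = 1 by omega, bernoulli_one, Nat.choose_succ_self_right, one_mul]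
  push_cast
  rw [mul_add, mul_add, mul_add, mul_add, Finset.mul_sum, Finset.mul_sum, Finset.mul_sum]
  have h0 : M * (M ^ j * (x / M) ^ (j + 1)) = x ^ (j + 1) := by
    rw [div_pow]; field_simp; ring
  have h1 : M * (M ^ j * (-1 / 2 * ((j : ℚ) + 1) * (x / M) ^ j)) =
      -(((j : ℚ) + 1) / 2 * x ^ j * M) := by
    rw [div_pow]; field_simp
  rw [h0, h1]
  have hterm : ∀ i ∈ range j, M * (M ^ j * (_root_.bernoulli (j + 1 - i) *
      ((j + 1).choose i : ℚ) * (x / M) ^ i)) =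
      M ^ 2 * ((_root_.bernoulli (j + 1 - i) * (((j + 1).choose i : ℕ) : ℚ) : ℚ) *
        x ^ i * M ^ (j - 1 - i)) := by
    intro i hi
    rw [Finset.mem_range] at hi
    have hpow : M ^ j = M * (M ^ i * M ^ (j - 1 - i)) := by
      rw [← pow_add, show M * M ^ (i + (j - 1 - i)) = M ^ (i + (j - 1 - i) + 1) from (pow_succ' _ _).symm]
      congr 1; omega
    rw [div_pow]
    have hMe : M ^ i ≠ 0 := pow_ne_zero _ hM
    field_simp
    rw [hpow]
    ring
  rw [Finset.sum_congr rfl hterm]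
  ring

end Expansion

/-! ### E 2 / Theorem 2.1 (ii) -/

section ETwo

variable (p : ℕ) [Fact p.Prime]

/-- The `p`-adic size of the "lower terms" `∑_{i<j} B_{j+1-i} C x^{i} M^{j-1-i}` for integers
`x`, `M`: at most `∑_{i ≤ j+1} ‖B_i‖_p`. [folklore] -/
private theorem norm_lowerTerms_le (j x M : ℕ) :
    ‖((∑ i ∈ range j, (_root_.bernoulli (j + 1 - i) * ((j + 1).choose i : ℕ) : ℚ) *
        (x : ℚ) ^ i * (M : ℚ) ^ (j - 1 - i) : ℚ) : ℚ_[p])‖ ≤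
      ∑ i ∈ range (j + 2), ‖((_root_.bernoulli i : ℚ) : ℚ_[p])‖ := by
  push_cast
  refine IsUltrametricDist.norm_sum_le_of_forall_le_of_nonneg
    (Finset.sum_nonneg fun _ _ ↦ norm_nonneg _) fun i hi ↦ ?_
  rw [Finset.mem_range] at hi
  have hle : ‖((_root_.bernoulli (j + 1 - i) : ℚ) : ℚ_[p])‖ ≤
      ∑ i ∈ range (j + 2), ‖((_root_.bernoulli i : ℚ) : ℚ_[p])‖ :=
    Finset.single_le_sum (f := fun i ↦ ‖((_root_.bernoulli i : ℚ) : ℚ_[p])‖)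
      (fun _ _ ↦ norm_nonneg _) (Finset.mem_range.mpr (by omega))
  refine le_trans ?_ hle
  rw [norm_mul, norm_mul, norm_mul]
  have h1 : ‖(((j + 1).choose i : ℕ) : ℚ_[p])‖ ≤ 1 := by
    exact_mod_cast Padic.norm_int_le_one (((j + 1).choose i : ℕ) : ℤ)
  have h2 : ‖(x : ℚ_[p]) ^ i‖ ≤ 1 := by
    rw [norm_pow]
    exact pow_le_one₀ (norm_nonneg _) (by exact_mod_cast Padic.norm_int_le_one (x : ℤ))
  have h3 : ‖(M : ℚ_[p]) ^ (j - 1 - i)‖ ≤ 1 := by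
    rw [norm_pow]
    exact pow_le_one₀ (norm_nonneg _) (by exact_mod_cast Padic.norm_int_le_one (M : ℤ))
  calc _ ≤ ‖((_root_.bernoulli (j + 1 - i) : ℚ) : ℚ_[p])‖ * 1 * 1 * 1 := by
        gcongr
    _ = _ := by ring

/-- Ultrametric bookkeeping: four terms of norm `≤ D` combine to norm `≤ D`. [folklore] -/
private theorem norm_combination_le {u v w s : ℚ_[p]} {D : ℝ} (hu : ‖u‖ ≤ D) (hv : ‖v‖ ≤ D)
    (hw : ‖w‖ ≤ D) (hs : ‖s‖ ≤ D) : ‖-u + v + w - s‖ ≤ D := by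
  have hsub : ∀ a b : ℚ_[p], ‖a - b‖ ≤ max ‖a‖ ‖b‖ := fun a b ↦ by
    simpa only [sub_eq_add_neg, norm_neg] using IsUltrametricDist.norm_add_le_max a (-b)
  refine (hsub _ _).trans (max_le ?_ hs)
  refine (IsUltrametricDist.norm_add_le_max _ _).trans (max_le ?_ hw)
  refine (IsUltrametricDist.norm_add_le_max _ _).trans (max_le ?_ hv)
  rwa [norm_neg]

/-- **Lang Ch. 2 §2, E 2 / Theorem 2.1 (ii), at an odd prime `p`**: there is a constant `D`
(depending only on `k ≥ 1` and `p`) such that for every `M ≥ 1`, every `c` prime to `M` and every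
`b ∈ ℤ/Mℤ`,
`‖k E_{k,c}^{(M)}(b) − k · b.val^{k-1} · E_{1,c}^{(M)}(b)‖_p ≤ D ‖M‖_p`
("`E_{k,c}^{(N)}(x) ≡ x^{k-1} E_{1,c}^{(N)}(x) mod N ℤ_p`").  Proof as in Lang: write
`c · (bc⁻¹).val = b.val + tM`, expand `B_k = X^k − (k/2)X^{k-1} + …` (**B 5**) at `b.val/M` and
at `(bc⁻¹).val/M`, and observe that `(b.val + tM)^k − b.val^k − k b.val^{k-1} tM ∈ (tM)²ℤ`.
[cite: LangCyclotomic1990, Ch. 2 §2, E 2 and Thm. 2.1 (ii) (PDF pp. 35–36)] -/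
theorem exists_norm_regBernoulliDist_sub_le (hp : p ≠ 2) {k : ℕ} (hk : 1 ≤ k) :
    ∃ D : ℝ, 1 ≤ D ∧ ∀ (M : ℕ) [NeZero M] (c : ℕ), c.Coprime M → ∀ b : ZMod M,
      ‖((regBernoulliDist k M c b : ℚ) : ℚ_[p]) -
          (k : ℚ_[p]) * ((b.val : ℚ_[p])) ^ (k - 1) * ((regBernoulliDist 1 M c b : ℚ) : ℚ_[p])‖ ≤
        D * ‖(M : ℚ_[p])‖ := by
  obtain ⟨j, rfl⟩ : ∃ j, k = j + 1 := ⟨k - 1, by omega⟩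
  rw [Nat.add_sub_cancel]
  set D : ℝ := 1 + ∑ i ∈ range (j + 2), ‖((_root_.bernoulli i : ℚ) : ℚ_[p])‖ with hD
  have hD0 : 0 ≤ ∑ i ∈ range (j + 2), ‖((_root_.bernoulli i : ℚ) : ℚ_[p])‖ :=
    Finset.sum_nonneg fun _ _ ↦ norm_nonneg _
  have hD1 : 1 ≤ D := by rw [hD]; linarith
  refine ⟨D, hD1, fun M _ c hc b ↦ ?_⟩
  have hM : (M : ℚ) ≠ 0 := by exact_mod_cast NeZero.ne M
  obtain ⟨t, ht⟩ := exists_mul_val_mul_inv_eq hc b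
  set w := b * (c : ZMod M)⁻¹ with hw
  -- the "lower terms"
  set S : ℕ → ℚ := fun y ↦ ∑ i ∈ range j, (_root_.bernoulli (j + 1 - i) * ((j + 1).choose i : ℕ) : ℚ) *
      (y : ℚ) ^ i * (M : ℚ) ^ (j - 1 - i) with hS
  -- the expansions (B 5)
  have hEx : (M : ℚ) * bernoulliDist (j + 1) M b =
      (b.val : ℚ) ^ (j + 1) - ((j : ℚ) + 1) / 2 * (b.val : ℚ) ^ j * M + (M : ℚ) ^ 2 * S b.val := by
    rw [bernoulliDist, Nat.add_sub_cancel]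
    exact mul_bernoulli_eval_div_eq j hM b.val
  have hEw : (M : ℚ) * bernoulliDist (j + 1) M w =
      (w.val : ℚ) ^ (j + 1) - ((j : ℚ) + 1) / 2 * (w.val : ℚ) ^ j * M + (M : ℚ) ^ 2 * S w.val := by
    rw [bernoulliDist, Nat.add_sub_cancel]
    exact mul_bernoulli_eval_div_eq j hM w.val
  have hE1x : (M : ℚ) * bernoulliDist 1 M b = (b.val : ℚ) - M / 2 := by
    rw [bernoulliDist]
    simp only [Nat.sub_self, pow_zero, one_mul, Polynomial.bernoulli_one, Polynomial.eval_sub,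
      Polynomial.eval_X, Polynomial.eval_C]
    field_simp
  have hE1w : (M : ℚ) * bernoulliDist 1 M w = (w.val : ℚ) - M / 2 := by
    rw [bernoulliDist]
    simp only [Nat.sub_self, pow_zero, one_mul, Polynomial.bernoulli_one, Polynomial.eval_sub,
      Polynomial.eval_X, Polynomial.eval_C]
    field_simp
  -- the arithmetic of `c · w.val = b.val + tM`
  have ht' : (c : ℚ) * (w.val : ℚ) = (b.val : ℚ) + (t : ℚ) * M := by exact_mod_cast ht
  obtain ⟨z, hz⟩ := sq_dvd_add_pow_sub_sub ((t : ℤ) * M) (b.val : ℤ) (j + 1)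
  obtain ⟨q, hq⟩ := sub_dvd_pow_sub_pow ((b.val : ℤ) + t * M) (b.val : ℤ) j
  have hA : ((c : ℚ) * w.val) ^ (j + 1) = (b.val : ℚ) ^ (j + 1) +
      ((j : ℚ) + 1) * (b.val : ℚ) ^ j * ((t : ℚ) * M) + ((t : ℚ) * M) ^ 2 * z := by
    have h := congr_arg (fun u : ℤ ↦ (u : ℚ)) hz
    simp only [Nat.add_sub_cancel] at h
    push_cast at h
    rw [ht']
    linear_combination h
  have hB : ((c : ℚ) * w.val) ^ j = (b.val : ℚ) ^ j + ((t : ℚ) * M) * q := by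
    have h := congr_arg (fun u : ℤ ↦ (u : ℚ)) hq
    push_cast at h
    rw [ht']
    linear_combination h
  -- the identity `Δ = M · R`
  set R : ℚ := -((t : ℚ) ^ 2 * z) + ((j : ℚ) + 1) * c / 2 * t * q + S b.val -
    (c : ℚ) ^ (j + 1) * S w.val with hR
  have key' : (M : ℚ) * (regBernoulliDist (j + 1) M c b -
      ((j + 1 : ℕ) : ℚ) * (b.val : ℚ) ^ j * regBernoulliDist 1 M c b) = M * (M * R) := by
    unfold regBernoulliDist
    rw [← hw, hR]
    push_cast
    linear_combination hEx - (c : ℚ) ^ (j + 1) * hEw - ((j : ℚ) + 1) * (b.val : ℚ) ^ j * hE1x +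
      ((j : ℚ) + 1) * (b.val : ℚ) ^ j * (c : ℚ) * hE1w - hA +
      (((j : ℚ) + 1) * c * M / 2) * hB + (((j : ℚ) + 1) * (b.val : ℚ) ^ j) * ht'
  have key : regBernoulliDist (j + 1) M c b -
      ((j + 1 : ℕ) : ℚ) * (b.val : ℚ) ^ j * regBernoulliDist 1 M c b = M * R :=
    mul_left_cancel₀ hM key'
  -- sizes
  have h2 : ‖(2 : ℚ_[p])‖ = 1 := by
    rw [show (2 : ℚ_[p]) = ((2 : ℕ) : ℚ_[p]) by norm_cast, Padic.norm_natCast_eq_one_iff]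
    exact (Nat.coprime_primes (Fact.out : p.Prime) Nat.prime_two).mpr hp
  have hnat : ∀ n : ℕ, ‖(n : ℚ_[p])‖ ≤ 1 := fun n ↦ by
    exact_mod_cast Padic.norm_int_le_one (n : ℤ)
  have hint : ∀ n : ℤ, ‖(n : ℚ_[p])‖ ≤ 1 := fun n ↦ Padic.norm_int_le_one n
  have hD' : ∑ i ∈ range (j + 2), ‖((_root_.bernoulli i : ℚ) : ℚ_[p])‖ ≤ D := by
    rw [hD]; linarith
  have hu : ‖((t : ℚ_[p])) ^ 2 * (z : ℚ_[p])‖ ≤ D := by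
    rw [norm_mul, norm_pow]
    calc _ ≤ (1 : ℝ) ^ 2 * 1 := by
          gcongr
          · exact hnat t
          · exact hint z
      _ ≤ D := by linarith
  have hv : ‖((j : ℚ_[p]) + 1) * (c : ℚ_[p]) / 2 * (t : ℚ_[p]) * (q : ℚ_[p])‖ ≤ D := by
    rw [norm_mul, norm_mul, norm_div, norm_mul, h2, div_one]
    have hj : ‖(j : ℚ_[p]) + 1‖ ≤ 1 := by exact_mod_cast Padic.norm_int_le_one ((j : ℤ) + 1)
    calc _ ≤ 1 * 1 * 1 * 1 := by
          gcongr
          · exact hnat c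
          · exact hnat t
          · exact hint q
      _ ≤ D := by linarith
  have hw' : ‖((S b.val : ℚ) : ℚ_[p])‖ ≤ D := (norm_lowerTerms_le p j b.val M).trans hD'
  have hs : ‖(c : ℚ_[p]) ^ (j + 1) * ((S w.val : ℚ) : ℚ_[p])‖ ≤ D := by
    rw [norm_mul, norm_pow]
    calc _ ≤ (1 : ℝ) ^ (j + 1) * ∑ i ∈ range (j + 2), ‖((_root_.bernoulli i : ℚ) : ℚ_[p])‖ := by
          gcongr
          · exact hnat c
          · exact norm_lowerTerms_le p j w.val M
      _ ≤ D := by rw [one_pow, one_mul]; exact hD'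
  have hRle : ‖((R : ℚ) : ℚ_[p])‖ ≤ D := by
    have e : ((R : ℚ) : ℚ_[p]) = -(((t : ℚ_[p])) ^ 2 * (z : ℚ_[p])) +
        ((j : ℚ_[p]) + 1) * (c : ℚ_[p]) / 2 * (t : ℚ_[p]) * (q : ℚ_[p]) +
        ((S b.val : ℚ) : ℚ_[p]) - (c : ℚ_[p]) ^ (j + 1) * ((S w.val : ℚ) : ℚ_[p]) := by
      rw [hR]; push_cast; ring
    rw [e]
    exact norm_combination_le p hu hv hw' hs
  -- conclusion
  have hcast : ((regBernoulliDist (j + 1) M c b : ℚ) : ℚ_[p]) -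
      ((j + 1 : ℕ) : ℚ_[p]) * ((b.val : ℚ_[p])) ^ j * ((regBernoulliDist 1 M c b : ℚ) : ℚ_[p]) =
      (M : ℚ_[p]) * ((R : ℚ) : ℚ_[p]) := by
    have h := congr_arg (fun u : ℚ ↦ (u : ℚ_[p])) key
    push_cast at h ⊢
    exact h
  rw [hcast, norm_mul, mul_comm]
  exact mul_le_mul_of_nonneg_right hRle (norm_nonneg _)

end ETwo

end Literature.NumberTheory.EllipticCurves

end
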